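import Mathlib
import HarnessLib
import Literature.Analysis.FluidPDE.NSVorticityBKMHolds
import Literature.Analysis.FluidPDE.TaoLocalisationHolds
import Summits.NavierStokesRegularity.NavierStokesRegularity.Theses.IsobarTomography

/-!
# Crux `IsobarTomography.BlobRiccatiClosure` (stmt-NavierStokesRegularity-11740), line `Sketch`,
# stub S1 `stub_continuation` — continuation from a late vorticity bound (PROVED)

Registered stub S1 of the peak-reduction skeleton `Cruxes/BlobRiccatiClosure/Lines/Sketch.lean`:
a classical solution of the unforced Navier–Stokes system on `ℝ³ × [0, T)` which is Leray–Hopf from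
its rapidly decaying datum and whose squared vorticity is bounded on `[t₀, T) × ℝ³` for some
`t₀ < T` extends classically past `T`.

Proof (every ingredient is a theorem of the tree; no named fact is assumed): Tao 2013, Cor. 11.1
(`tao2011_hasBoundedSobolevNormsOn_holds`, through `tao2011_hasBoundedSobolevNormsOn.closedSlab`) puts
the solution in the Beale–Kato–Majda class on every closed slab `[0, T₁]`, `T₁ < T`; the Sobolev
imbedding (`exists_enorm_curl_le_of_hasBoundedSobolevNormsOn`) bounds the vorticity on
`[0, max t₀ (T/2)]`; with the hypothesis the BKM integral `∫₀ᵀ ‖curl u(t)‖_∞ dt` is finite and the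
discharged criterion `beale_kato_majda_holds` continues the solution in the class, hence smoothly
(`HasSobolevExtensionPast.hasSmoothExtensionPast`). Adapted from
`coreLogGas_coreReductionContinuation_proof` (route CoreLogGas).

References: J. T. Beale, T. Kato, A. Majda, Comm. Math. Phys. 94 (1984), Thm. 1; T. Tao,
Anal. PDE 6 (2013), Cor. 11.1.
-/

noncomputable section

open MeasureTheory Set Function Filter Topology
open scoped ENNReal NNReal

-- the summit and its single sub-problem share the name (CONVENTIONS §1), as in every Theorems file
set_option linter.dupNamespace false

namespace Summit.NavierStokesRegularity.NavierStokesRegularity.Theorems.BlobRiccatiClosure.Sketch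

open Literature.Analysis Literature.Analysis.FluidPDE

local notation "E³" => EuclideanSpace ℝ (Fin 3)

/-- **S1, CONTINUATION FROM A LATE VORTICITY BOUND.** A classical solution of unforced
Navier–Stokes on `ℝ³ × [0, T)`, Leray–Hopf from its rapidly decaying datum, whose squared vorticity
is bounded by `B` on `[t₀, T) × ℝ³` for some `t₀ < T`, extends classically past `T`.
Proof: Tao 2013 (`tao2011_hasBoundedSobolevNormsOn_holds`) puts the solution in the BKM class on every
closed slab `[0, T₁]`, `T₁ < T`; Sobolev imbedding bounds the vorticity on `[0, max t₀ (T/2)]`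
(`exists_enorm_curl_le_of_hasBoundedSobolevNormsOn`); so `∫₀ᵀ ‖curl u‖_∞ < ∞` and the discharged
Beale–Kato–Majda criterion `beale_kato_majda_holds` continues the solution in the class.
(Adapted from `coreLogGas_coreReductionContinuation_proof`.) -/
theorem stub_continuation :
    ∀ (ν T t₀ B : ℝ) (u : ℝ → E³ → E³) (p : ℝ → E³ → ℝ), 0 < ν → 0 < T → t₀ < T →
      IsClassicalNSSolutionOn (Ico 0 T) ν 0 u p → IsLerayHopfOn T ν 0 (u 0) u →
      HasRapidSpatialDecay (u 0) →
      (∀ t ∈ Ico t₀ T, ∀ x : E³, ‖curl (u t) x‖ ^ 2 ≤ B) →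
      HasSmoothExtensionPast ν 0 u T := by
  intro ν T t₀ B u p hν hT ht₀T hcl hLH hdec hB
  -- Step 1: the vorticity is bounded by `√|B|` on `[t₀, T)`
  have hΩ : ∀ t ∈ Ico t₀ T, ∀ x, ‖curl (u t) x‖ ≤ Real.sqrt |B| := by
    intro t ht x
    have h1 : ‖curl (u t) x‖ ^ 2 ≤ |B| := (hB t ht x).trans (le_abs_self B)
    calc ‖curl (u t) x‖ = Real.sqrt (‖curl (u t) x‖ ^ 2) := by
          rw [Real.sqrt_sq (norm_nonneg _)]
      _ ≤ Real.sqrt |B| := Real.sqrt_le_sqrt h1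
  -- Step 2: the BKM class on closed slabs (Tao 2013, Cor. 11.1)
  have hslab : ∀ T₁ ∈ Ioo 0 T, HasBoundedSobolevNormsOn (Icc 0 T₁) u := by
    intro T₁ hT₁
    have hsol' : IsClassicalNSSolutionOn (Icc 0 T₁) ν 0 u p :=
      hcl.mono (Icc_subset_Ico_right hT₁.2) (uniqueDiffOn_Icc hT₁.1)
    have hEn' : ∃ C : ℝ≥0∞, C < ⊤ ∧ ∀ t ∈ Icc 0 T₁, ∫⁻ x, ‖u t x‖ₑ ^ 2 ≤ C :=
      ⟨_, ENNReal.ofReal_lt_top, fun t ht =>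
        hLH.lintegral_enorm_sq_le hν.le ⟨ht.1, ht.2.trans hT₁.2.le⟩⟩
    exact (tao2011_hasBoundedSobolevNormsOn.closedSlab tao2011_hasBoundedSobolevNormsOn_holds
      linfty_bound_of_hasBoundedSobolevNormsOn_holds ν T₁ hν hT₁.1 u p hsol' hEn' hdec).1
  have hreg : ∀ T'' < T, HasBoundedSobolevNormsOn (Icc 0 T'') u := by
    intro T'' hT''
    have h1 : max T'' (T / 2) ∈ Ioo 0 T :=
      ⟨lt_max_of_lt_right (by linarith), max_lt hT'' (by linarith)⟩
    exact (hslab _ h1).mono (Icc_subset_Icc_right (le_max_left _ _))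
  -- Step 3: the vorticity is bounded on `[0, t₁]`, `t₁ = max t₀ (T/2)` (Sobolev imbedding)
  set t₁ : ℝ := max t₀ (T / 2) with ht₁
  have ht₁I : t₁ ∈ Ioo 0 T := ⟨lt_max_of_lt_right (by linarith), max_lt ht₀T (by linarith)⟩
  obtain ⟨R₁, hR₁, hR₁b⟩ := exists_enorm_curl_le_of_hasBoundedSobolevNormsOn
    (fun t ht => hcl.contDiff_velocity ⟨ht.1, ht.2.trans_lt ht₁I.2⟩) (hslab t₁ ht₁I)
  -- Step 4: the BKM integral `∫₀ᵀ ‖curl u(t)‖_∞ dt` is finite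
  have hbound : ∀ t ∈ Ioo 0 T, (⨆ x, ‖curl (u t) x‖ₑ) ≤ R₁ + ENNReal.ofReal (Real.sqrt |B|) := by
    intro t ht
    refine iSup_le fun x => ?_
    rcases le_or_gt t t₁ with h | h
    · exact (hR₁b t ⟨ht.1.le, h⟩ x).trans le_self_add
    · have htI : t ∈ Ico t₀ T := ⟨(le_max_left _ _).trans h.le, ht.2⟩
      calc ‖curl (u t) x‖ₑ = ENNReal.ofReal ‖curl (u t) x‖ := (ofReal_norm _).symm
        _ ≤ ENNReal.ofReal (Real.sqrt |B|) := ENNReal.ofReal_le_ofReal (hΩ t htI x)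
        _ ≤ R₁ + ENNReal.ofReal (Real.sqrt |B|) := le_add_self
  have hfin : (∫⁻ t in Ioo 0 T, ⨆ x, ‖curl (u t) x‖ₑ) < ⊤ := by
    calc (∫⁻ t in Ioo 0 T, ⨆ x, ‖curl (u t) x‖ₑ)
        ≤ ∫⁻ _ in Ioo 0 T, (R₁ + ENNReal.ofReal (Real.sqrt |B|)) :=
          setLIntegral_mono' measurableSet_Ioo hbound
      _ = (R₁ + ENNReal.ofReal (Real.sqrt |B|)) * volume (Ioo (0 : ℝ) T) := setLIntegral_const _ _
      _ < ⊤ := by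
          refine ENNReal.mul_lt_top (ENNReal.add_lt_top.2 ⟨hR₁, ENNReal.ofReal_lt_top⟩) ?_
          rw [Real.volume_Ioo]
          exact ENNReal.ofReal_lt_top
  -- Step 5: Beale–Kato–Majda continues the solution in the class, hence smoothly, past `T`
  exact ((beale_kato_majda_holds hν.le hT hcl hreg).2 hfin).hasSmoothExtensionPast

end Summit.NavierStokesRegularity.NavierStokesRegularity.Theorems.BlobRiccatiClosure.Sketch

end
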